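import Literature.NumberTheory.GaloisRepresentations.HeckeCharacterSharpModulusProofs
import Literature.NumberTheory.GaloisRepresentations.GrossencharakterSharpModulus
import HarnessLib

/-!
# The CONDUCTOR of an ideal Größencharakter datum and its PRIMITIVE companion — proofs

Topic `NumberTheory/GaloisRepresentations`; namespace `Literature.NumberTheory.GaloisRepresentations`.  THEOREMS ONLY (no definition,
no named fact, no instance, no `sorry`).  Sequel of `GrossencharakterSharpModulus.lean` (`IsGrossencharakter.exists_sharp`: the SUPPORT of
the modulus can be taken to be the ramification, exponents not minimal) and `HeckeCharacterSharpModulusProofs.lean` (the conductor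
`(ram χ, f(χ_·))` of an idelic Hecke character is a module of definition; the ideal character is a Größencharakter modulo
`∏_{v ∈ ram χ} 𝔭_v^{f(χ_v)}`).  Here the exponents are made MINIMAL (Neukirch VII §6, after (6.11): «the smallest module of definition
… the conductor»; Def. (6.2)-style primitivity): for a datum `ψ mod 𝔣` of type `(p, q)` with Hecke character `ω = heckeOfGross h𝔣 hψ`,
the ideal `𝔠 := ∏_{v ∈ ram ω} 𝔭_v^{f(ω_v)}` (written out; no definition is introduced) and the values `ψ₀ v := ω(ϖ_v)` satisfy

* `heckeOfGross_isTrivialOnHigherUnitsAt`, `conductorExponentAt_heckeOfGross_le` — `f(ω_v) ≤ ν_v(𝔣)` (`ω` is trivial on `U_v^{(ν_v(𝔣))}`);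
* `IsGrossencharakter.conductor_ne_bot`, `.le_conductor` (`𝔣 ⊆ 𝔠`, i.e. `𝔠 ∣ 𝔣`), `.conductor_le_asIdeal_iff` (the primes of `𝔠` are
  EXACTLY the ramified places of `ω`, all of them primes of `𝔣`), `.isGrossencharakter_conductor` (`ψ₀` is a Größencharakter mod `𝔠`;
  `ψ₀ = ψ` off `𝔣` is the tree's `heckeOfGross_valueAtUniformizer`);
* ★ `IsGrossencharakter.eq_conductor_of_le` — **PRIMITIVITY**: if `𝔠 ⊆ 𝔣₁` (`𝔣₁ ∣ 𝔠`) and some `ψ₁` agreeing with `ψ₀` off `𝔠` is a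
  Größencharakter mod `𝔣₁` of the same type, then `𝔣₁ = 𝔠` (multiplicity one for `GL(1)` + minimality of the conductor exponents);
* ★★ `IsGrossencharakter.exists_primitive` — the package: a primitive companion `(𝔠, ψ₀)` of any datum `(𝔣, ψ)`.

References: [NeukirchANT1999] Ch. VII §6 Def. (6.1), (6.10)–(6.11), Prop. (6.13), Cor. (6.14); [CasselsFrohlichANT1967] Ch. VII (Tate) §4
Prop. 4.1 (multiplicity one).  Filed for the de-cite of Ribet's bad Euler factors (Shimura: the theta series of a PRIMITIVE Größencharakter is
a newform of level `|d_K|·N𝔠`) in crux L `SmallImageLowerHalfBothSigns` of `Summits/BirchSwinnertonDyer`; nothing about BSD is proved here.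

## Mathlib / tree search
Tree: `heckeOfGross`, `heckeOfGross_apply_of_mem`, `heckeOfGross_valueAtUniformizer`, `heckeOfGross_isUnramifiedAt`, `heckeOfGross_hasInfinityType`
(`HeckeCharacterOfGrossencharakter`); `eq_heckeOfGross_of_eventually_valueAtUniformizer_eq` (`GrossencharakterSharpModulus`); `congruenceIdeles`,
`modulusExp`, `grossIdeleValue_localUnits_of_valued_eq_one`; `isGrossencharakter_valueAtUniformizer_conductor`, `prod_pow_asIdeal_le_iff`,
`conductorExponentAt_le_of_isTrivialOnHigherUnitsAt` (`HeckeCharacterSharpModulusProofs`).  Mathlib: `IsDedekindDomain.HeightOneSpectrum.inf_pow_eq_prod`,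
`Ideal.iInf_maxPowDividing_eq` (`𝔣 ⊆ 𝔭_v^{ν_v(𝔣)}`), `Ideal.pow_le_pow_right`.  `lean search 'exists_primitive|eq_conductor_of_le|conductor_ne_bot'` (2026-08-31): nothing relevant.
-/

noncomputable section

open scoped NumberField
open NumberField IsDedekindDomain Filter

namespace Literature.NumberTheory.GaloisRepresentations

variable {K : Type} [Field K] [NumberField K]

/-! ### §1 `heckeOfGross` is trivial on `U_v^{(ν_v(𝔣))}`: its conductor divides `𝔣` -/

section Gross

variable {𝔣 : Ideal (𝓞 K)} {p q : InfinitePlace K → ℤ} {ψ : HeightOneSpectrum (𝓞 K) → ℂ}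

/-- A local unit idele `⟨u⟩_v` with `u ≡ 1 mod 𝔭_v^{ν_v(𝔣)}` lies in the congruence subgroup `W_𝔣` (at the other primes of `𝔣`
its component is `1`, at the real places `1 > 0`). [cite: NeukirchANT1999, Ch. VI §1 (1.7)–(1.9)] -/
theorem localUnits_mem_congruenceIdeles_of_valued_sub_one_le {v : HeightOneSpectrum (𝓞 K)} (u : (v.adicCompletion K)ˣ)
    (hu : Valued.v ((u : v.adicCompletion K) - 1) ≤ WithZero.exp (-(modulusExp 𝔣 v : ℤ))) :
    localUnits v u ∈ congruenceIdeles 𝔣 := by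
  refine ⟨fun w hw => ?_, fun w hw => ?_⟩
  · by_cases hwv : w = v
    · subst hwv
      rw [localUnits_snd_apply_self]
      exact hu
    · rw [localUnits_snd_apply_of_ne u hwv, sub_self, map_zero]
      exact zero_le
  · rw [localUnits_fst]
    change 0 < InfinitePlace.Completion.extensionEmbeddingOfIsReal hw 1
    rw [map_one]
    exact one_pos

/-- **`ω = heckeOfGross h𝔣 hψ` is trivial on `U_v^{(ν_v(𝔣))}` at every finite place** (`ω = ω₀` on `W_𝔣`, and `ω₀` kills unit
ideles; Neukirch VII (6.14): the Hecke character of a Größencharakter `mod 𝔣` has module of definition `𝔣`).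
[cite: NeukirchANT1999, Ch. VII §6 Cor. (6.14)] -/
theorem heckeOfGross_isTrivialOnHigherUnitsAt (h𝔣 : 𝔣 ≠ ⊥) (hψ : IsGrossencharakter 𝔣 p q ψ) (v : HeightOneSpectrum (𝓞 K)) :
    (heckeOfGross h𝔣 hψ).IsTrivialOnHigherUnitsAt v (modulusExp 𝔣 v) := by
  intro u hu
  have hmem : localUnits v (Units.map ((v.adicCompletionIntegers K).subtype : _ →* _) u) ∈ congruenceIdeles 𝔣 :=
    localUnits_mem_congruenceIdeles_of_valued_sub_one_le _ (by simpa using hu)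
  have hval : Valued.v ((Units.map ((v.adicCompletionIntegers K).subtype : _ →* _) u : (v.adicCompletion K)ˣ) :
      v.adicCompletion K) = 1 := by
    simpa using HeightOneSpectrum.adicCompletionIntegers.isUnit_iff_valued_eq_one.1 u.isUnit
  rw [HeckeCharacter.localComponent_apply, heckeOfGross_apply_of_mem h𝔣 hψ hmem]
  exact grossIdeleValue_localUnits_of_valued_eq_one hψ v hval

/-- **The conductor of `heckeOfGross h𝔣 hψ` divides `𝔣`**: `f(ω_v) ≤ ν_v(𝔣)` at every finite place.
[cite: NeukirchANT1999, Ch. VII §6 (6.11) and Cor. (6.14)] -/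
theorem conductorExponentAt_heckeOfGross_le (h𝔣 : 𝔣 ≠ ⊥) (hψ : IsGrossencharakter 𝔣 p q ψ) (v : HeightOneSpectrum (𝓞 K)) :
    (heckeOfGross h𝔣 hψ).conductorExponentAt v ≤ modulusExp 𝔣 v :=
  HeckeCharacter.conductorExponentAt_le_of_isTrivialOnHigherUnitsAt (heckeOfGross_isTrivialOnHigherUnitsAt h𝔣 hψ v)

end Gross

/-! ### §2 Ideal bookkeeping: `𝔞 ⊆ 𝔭_v^{ν_v(𝔞)}`, and containment in a product of prime powers from exponent bounds -/

/-- `𝔞 ⊆ 𝔭_v^{ν_v(𝔞)}` for a non-zero ideal (unique factorisation: `𝔞 = ⨅_v 𝔭_v^{ν_v(𝔞)}`). [cite: NeukirchANT1999, Ch. I §3 (3.3)] -/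
theorem le_pow_modulusExp {𝔞 : Ideal (𝓞 K)} (h𝔞 : 𝔞 ≠ ⊥) (v : HeightOneSpectrum (𝓞 K)) :
    𝔞 ≤ v.asIdeal ^ modulusExp 𝔞 v := by
  have h := iInf_le (fun w : HeightOneSpectrum (𝓞 K) => w.maxPowDividing 𝔞) v
  rw [Ideal.iInf_maxPowDividing_eq h𝔞] at h
  exact h

/-- If `ν_v`-wise `e_v ≤ ν_v(𝔞)` on `T`, then `𝔞 ⊆ ∏_{v∈T} 𝔭_v^{e_v}` (the product of distinct prime powers is their intersection).
[cite: NeukirchANT1999, Ch. I §3 (3.3)] -/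
theorem le_prod_pow_of_forall_le_modulusExp {𝔞 : Ideal (𝓞 K)} (h𝔞 : 𝔞 ≠ ⊥) {T : Finset (HeightOneSpectrum (𝓞 K))}
    {e : HeightOneSpectrum (𝓞 K) → ℕ} (he : ∀ v ∈ T, e v ≤ modulusExp 𝔞 v) :
    𝔞 ≤ ∏ v ∈ T, v.asIdeal ^ e v := by
  classical
  have hinf : (T.inf fun v => v.asIdeal ^ e v) = ∏ v ∈ T, v.asIdeal ^ e v :=
    IsDedekindDomain.HeightOneSpectrum.inf_pow_eq_prod T e id (fun i _ j _ hij => hij)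
  rw [← hinf]
  refine Finset.le_inf fun v hv => ?_
  exact (le_pow_modulusExp h𝔞 v).trans (Ideal.pow_le_pow_right (he v hv))

/-- Off the (finitely many) primes of a non-zero ideal, eventually along the cofinite filter: `∀ᶠ v, ¬ 𝔞 ⊆ 𝔭_v`
(Mathlib `Ideal.finite_factors`). [cite: NeukirchANT1999, Ch. I §3 (3.3)] -/
theorem eventually_not_le_asIdeal' {𝔞 : Ideal (𝓞 K)} (h𝔞 : 𝔞 ≠ ⊥) : ∀ᶠ v : HeightOneSpectrum (𝓞 K) in cofinite, ¬ 𝔞 ≤ v.asIdeal :=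
  eventually_cofinite.mpr ((Ideal.finite_factors h𝔞).subset fun v hv => by
    by_contra hle; exact hv fun hle' => hle (Ideal.dvd_iff_le.mpr hle'))

/-! ### §3 The conductor of a datum and its primitive companion -/

section Primitive

variable {𝔣 : Ideal (𝓞 K)} {p q : InfinitePlace K → ℤ} {ψ : HeightOneSpectrum (𝓞 K) → ℂ}

/-- `𝔠 ≠ 0`. [cite: NeukirchANT1999, Ch. VII §6 (6.11)] -/
theorem IsGrossencharakter.conductor_ne_bot (h𝔣 : 𝔣 ≠ ⊥) (hψ : IsGrossencharakter 𝔣 p q ψ) :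
    (∏ v ∈ (HeckeCharacter.finite_ramifiedPlaces_holds (heckeOfGross h𝔣 hψ)).toFinset,
      v.asIdeal ^ (heckeOfGross h𝔣 hψ).conductorExponentAt v : Ideal (𝓞 K)) ≠ ⊥ :=
  HeckeCharacter.prod_pow_asIdeal_ne_bot _ _

/-- **The primes of `𝔠` are exactly the ramified places of `ω`.** [cite: NeukirchANT1999, Ch. VII §6 (6.11)] -/
theorem IsGrossencharakter.conductor_le_asIdeal_iff (h𝔣 : 𝔣 ≠ ⊥) (hψ : IsGrossencharakter 𝔣 p q ψ) (w : HeightOneSpectrum (𝓞 K)) :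
    (∏ v ∈ (HeckeCharacter.finite_ramifiedPlaces_holds (heckeOfGross h𝔣 hψ)).toFinset,
      v.asIdeal ^ (heckeOfGross h𝔣 hψ).conductorExponentAt v : Ideal (𝓞 K)) ≤ w.asIdeal ↔
      ¬ (heckeOfGross h𝔣 hψ).IsUnramifiedAt w := by
  rw [HeckeCharacter.prod_pow_asIdeal_le_iff fun v hv => (heckeOfGross h𝔣 hψ).conductorExponentAt_pos_of_mem_toFinset hv,
    HeckeCharacter.mem_toFinset_ramifiedPlaces_iff]

/-- Every prime of `𝔠` is a prime of `𝔣` (`ω` is unramified off `𝔣`). [cite: NeukirchANT1999, Ch. VII §6 Cor. (6.14)] -/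
theorem IsGrossencharakter.le_asIdeal_of_conductor_le (h𝔣 : 𝔣 ≠ ⊥) (hψ : IsGrossencharakter 𝔣 p q ψ) {w : HeightOneSpectrum (𝓞 K)}
    (hw : (∏ v ∈ (HeckeCharacter.finite_ramifiedPlaces_holds (heckeOfGross h𝔣 hψ)).toFinset,
      v.asIdeal ^ (heckeOfGross h𝔣 hψ).conductorExponentAt v : Ideal (𝓞 K)) ≤ w.asIdeal) : 𝔣 ≤ w.asIdeal := by
  rw [hψ.conductor_le_asIdeal_iff h𝔣] at hw
  by_contra h
  exact hw (heckeOfGross_isUnramifiedAt h𝔣 hψ h)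

/-- **`𝔠 ∣ 𝔣`** (`𝔣 ⊆ 𝔠`): the conductor exponents are at most the exponents of `𝔣`. [cite: NeukirchANT1999, Ch. VII §6 (6.11) and Cor. (6.14)] -/
theorem IsGrossencharakter.le_conductor (h𝔣 : 𝔣 ≠ ⊥) (hψ : IsGrossencharakter 𝔣 p q ψ) :
    𝔣 ≤ ∏ v ∈ (HeckeCharacter.finite_ramifiedPlaces_holds (heckeOfGross h𝔣 hψ)).toFinset,
      v.asIdeal ^ (heckeOfGross h𝔣 hψ).conductorExponentAt v :=
  le_prod_pow_of_forall_le_modulusExp h𝔣 fun v _ => conductorExponentAt_heckeOfGross_le h𝔣 hψ v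

/-- **`ψ₀ := ω(ϖ_·)` is a Größencharakter modulo the conductor `𝔠`, of the same type `(p, q)`.** [cite: NeukirchANT1999, Ch. VII §6 Prop. (6.13) and Cor. (6.14)] -/
theorem IsGrossencharakter.isGrossencharakter_conductor (h𝔣 : 𝔣 ≠ ⊥) (hψ : IsGrossencharakter 𝔣 p q ψ) :
    IsGrossencharakter
      (∏ v ∈ (HeckeCharacter.finite_ramifiedPlaces_holds (heckeOfGross h𝔣 hψ)).toFinset,
        v.asIdeal ^ (heckeOfGross h𝔣 hψ).conductorExponentAt v) p q
      (fun v => (heckeOfGross h𝔣 hψ).valueAtUniformizer v) :=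
  HeckeCharacter.isGrossencharakter_valueAtUniformizer_conductor (heckeOfGross_hasInfinityType h𝔣 hψ)

/-- ★ **PRIMITIVITY of `(𝔠, ψ₀)`**: if `𝔠 ⊆ 𝔣₁` (i.e. `𝔣₁ ∣ 𝔠`) and a function `ψ₁` agreeing with `ψ₀` off `𝔠` is a Größencharakter
mod `𝔣₁` of type `(p, q)`, then `𝔣₁ = 𝔠`.  Proof: the Hecke character of `(𝔣₁, ψ₁)` agrees with `ω` at almost all uniformisers, so IS
`ω` (multiplicity one); hence `ω` is trivial on `U_v^{(ν_v(𝔣₁))}`, so `f(ω_v) ≤ ν_v(𝔣₁)` for all `v`, i.e. `𝔣₁ ⊆ 𝔠`.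
[cite: NeukirchANT1999, Ch. VII §6 (6.11), Cor. (6.14)] [cite: CasselsFrohlichANT1967, Ch. VII §4 Prop. 4.1] -/
theorem IsGrossencharakter.eq_conductor_of_le (h𝔣 : 𝔣 ≠ ⊥) (hψ : IsGrossencharakter 𝔣 p q ψ)
    {𝔣₁ : Ideal (𝓞 K)} {ψ₁ : HeightOneSpectrum (𝓞 K) → ℂ}
    (hle : (∏ v ∈ (HeckeCharacter.finite_ramifiedPlaces_holds (heckeOfGross h𝔣 hψ)).toFinset,
      v.asIdeal ^ (heckeOfGross h𝔣 hψ).conductorExponentAt v : Ideal (𝓞 K)) ≤ 𝔣₁)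
    (hagree : ∀ v : HeightOneSpectrum (𝓞 K),
      ¬ (∏ w ∈ (HeckeCharacter.finite_ramifiedPlaces_holds (heckeOfGross h𝔣 hψ)).toFinset,
          w.asIdeal ^ (heckeOfGross h𝔣 hψ).conductorExponentAt w : Ideal (𝓞 K)) ≤ v.asIdeal →
        ψ₁ v = (heckeOfGross h𝔣 hψ).valueAtUniformizer v)
    (hψ₁ : IsGrossencharakter 𝔣₁ p q ψ₁) :
    𝔣₁ = ∏ v ∈ (HeckeCharacter.finite_ramifiedPlaces_holds (heckeOfGross h𝔣 hψ)).toFinset,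
      v.asIdeal ^ (heckeOfGross h𝔣 hψ).conductorExponentAt v := by
  set ω := heckeOfGross h𝔣 hψ with hωdef
  have h𝔣₁ : 𝔣₁ ≠ ⊥ := by
    intro h
    rw [h, le_bot_iff] at hle
    exact hψ.conductor_ne_bot h𝔣 hle
  -- the Hecke character of `(𝔣₁, ψ₁)` is `ω` (multiplicity one)
  have hω₁ : heckeOfGross h𝔣₁ hψ₁ = ω := by
    refine eq_heckeOfGross_of_eventually_valueAtUniformizer_eq h𝔣 hψ ?_
    filter_upwards [eventually_not_le_asIdeal' (hψ.conductor_ne_bot h𝔣), eventually_not_le_asIdeal' h𝔣] with v hv₀ hv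
    have hv₁ : ¬ 𝔣₁ ≤ v.asIdeal := fun h => hv₀ (hle.trans h)
    rw [heckeOfGross_valueAtUniformizer h𝔣₁ hψ₁ hv₁, hagree v hv₀, hωdef, heckeOfGross_valueAtUniformizer h𝔣 hψ hv]
  -- minimality of the conductor exponents: `f(ω_v) ≤ ν_v(𝔣₁)`
  have hexp : ∀ v ∈ (HeckeCharacter.finite_ramifiedPlaces_holds (heckeOfGross h𝔣 hψ)).toFinset,
      (heckeOfGross h𝔣 hψ).conductorExponentAt v ≤ modulusExp 𝔣₁ v := fun v _ => by
    have h := heckeOfGross_isTrivialOnHigherUnitsAt h𝔣₁ hψ₁ v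
    rw [hω₁, hωdef] at h
    exact HeckeCharacter.conductorExponentAt_le_of_isTrivialOnHigherUnitsAt h
  exact le_antisymm (le_prod_pow_of_forall_le_modulusExp h𝔣₁ hexp) hle

/-- **Sharpness on realisations**: every Hecke character agreeing with `ψ₀` at almost all uniformisers IS `ω`, so the primes of `𝔠`
are exactly its ramified places. [cite: CasselsFrohlichANT1967, Ch. VII §4 Prop. 4.1] [cite: NeukirchANT1999, Ch. VII §6 (6.11)] -/
theorem IsGrossencharakter.conductor_le_asIdeal_iff_of_eventually (h𝔣 : 𝔣 ≠ ⊥) (hψ : IsGrossencharakter 𝔣 p q ψ)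
    {χ : HeckeCharacter K} (hχ : ∀ᶠ v in cofinite, χ.valueAtUniformizer v = (heckeOfGross h𝔣 hψ).valueAtUniformizer v)
    (w : HeightOneSpectrum (𝓞 K)) :
    (∏ v ∈ (HeckeCharacter.finite_ramifiedPlaces_holds (heckeOfGross h𝔣 hψ)).toFinset,
      v.asIdeal ^ (heckeOfGross h𝔣 hψ).conductorExponentAt v : Ideal (𝓞 K)) ≤ w.asIdeal ↔ ¬ χ.IsUnramifiedAt w := by
  have hχω : χ = heckeOfGross h𝔣 hψ := HeckeCharacter.ext_of_eventually_valueAtUniformizer_eq hχ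
  rw [hψ.conductor_le_asIdeal_iff h𝔣, hχω]

/-- ★★ **The primitive companion of a Größencharakter datum.**  For a datum `ψ mod 𝔣` of type `(p, q)` (`𝔣 ≠ 0`) there are an ideal
`𝔠 ≠ 0` with `𝔣 ⊆ 𝔠` (the CONDUCTOR) and values `ψ₀` (never zero) with: `IsGrossencharakter 𝔠 p q ψ₀`; `ψ₀ = ψ` off `𝔣`; the primes of `𝔠`
are EXACTLY the ramified places of every Hecke character realising `ψ₀`; and PRIMITIVITY — no `ψ₁` agreeing with `ψ₀` off `𝔠` is a
Größencharakter of type `(p, q)` modulo a proper divisor of `𝔠`.  (Neukirch VII §6: the conductor is the smallest module of definition; a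
Größencharakter mod its conductor is primitive.) [cite: NeukirchANT1999, Ch. VII §6 Def. (6.1), (6.11), Cor. (6.14)] [cite: CasselsFrohlichANT1967, Ch. VII §4 Prop. 4.1] -/
theorem IsGrossencharakter.exists_primitive (h𝔣 : 𝔣 ≠ ⊥) (hψ : IsGrossencharakter 𝔣 p q ψ) :
    ∃ (𝔠 : Ideal (𝓞 K)) (ψ₀ : HeightOneSpectrum (𝓞 K) → ℂ),
      𝔠 ≠ ⊥ ∧ 𝔣 ≤ 𝔠 ∧ IsGrossencharakter 𝔠 p q ψ₀ ∧
      (∀ v : HeightOneSpectrum (𝓞 K), ¬ 𝔣 ≤ v.asIdeal → ψ₀ v = ψ v) ∧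
      (∀ v : HeightOneSpectrum (𝓞 K), ψ₀ v ≠ 0) ∧
      (∀ χ : HeckeCharacter K, (∀ᶠ v in cofinite, χ.valueAtUniformizer v = ψ₀ v) →
        ∀ w : HeightOneSpectrum (𝓞 K), 𝔠 ≤ w.asIdeal ↔ ¬ χ.IsUnramifiedAt w) ∧
      (∀ (𝔣₁ : Ideal (𝓞 K)) (ψ₁ : HeightOneSpectrum (𝓞 K) → ℂ), 𝔠 ≤ 𝔣₁ →
        (∀ v : HeightOneSpectrum (𝓞 K), ¬ 𝔠 ≤ v.asIdeal → ψ₁ v = ψ₀ v) → IsGrossencharakter 𝔣₁ p q ψ₁ → 𝔣₁ = 𝔠) :=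
  ⟨_, fun v => (heckeOfGross h𝔣 hψ).valueAtUniformizer v, hψ.conductor_ne_bot h𝔣, hψ.le_conductor h𝔣,
    hψ.isGrossencharakter_conductor h𝔣, fun _ hv => heckeOfGross_valueAtUniformizer h𝔣 hψ hv,
    fun v => by simp only [HeckeCharacter.valueAtUniformizer]; exact Units.ne_zero _,
    fun _ hχ w => hψ.conductor_le_asIdeal_iff_of_eventually h𝔣 hχ w,
    fun _ _ hle hagree hψ₁ => hψ.eq_conductor_of_le h𝔣 hle hagree hψ₁⟩

end Primitive

end Literature.NumberTheory.GaloisRepresentations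

end
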